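import Summits.BirchSwinnertonDyer.Rank1Residual.Partition.CornersLargePrimeThirteen
import Literature.NumberTheory.EllipticCurves.Greenberg1999.IsogenyPrimesOrdinaryMultiplicative
import HarnessLib

/-!
# Greenberg's list `{2, 3, 5, 7, 13, 37}` of ordinary-or-multiplicative Eisenstein primes
# (LNM 1716 p. 136, registry fact A163) is DERIVED in the kernel from Mazur 1978 Thm. 1 and the
# `j`-table of the positive-genus isogeny levels

HONEST FRAMING (cell `b2b-bsdres-*`, verbatim): the goal of the cell is to DELETE the
COMBINATION-SHAPED residual classes for ALL analytic-rank ≤ 1 curves over ℚ — "full BSD formula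
for every rank ≤ 1 curve in class C" assembled STRICTLY from published theorems — so that the
rank-≤1 remainder becomes exactly the CONSTRUCTION-SHAPED classes, which are TYPED (missing-input
Props), NOT attempted; this is not "finishing BSD". Off-peak literature typer `b2b-bsdres-lit-cgls`
(session 11): theorems only, no definition, no named fact, nothing booked, no label changed.

The named fact `Greenberg1999.p136_mem_isogenyPrimes_of_reducible` (Greenberg, LNM 1716 (1999)
§5 p. 136: "`E/ℚ` with good ordinary or multiplicative reduction at `p` and `E[p]` reducible ⟹
`p ∈ {2, 3, 5, 7, 13, 37}`"; registry A163, `hGr136` in `Partition/CornersLargePrime*.lean`) is the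
printed CONSEQUENCE of Mazur, Invent. Math. 44 (1978) Thm. 1 (`mazur_isogeny_irreducible`, binder
`hMaz`) and the eleven `j`-invariants of the rational isogenies of prime degree
`ℓ ∈ {11, 17, 19, 37, 43, 67, 163}` (`primeDegreeIsogeny_jTable`, binder `hT`; Cremona *Algorithms*
§3.8 p. 82, Mazur 1978 table p. 129). Sub-cell `eisenstein-p1` proved the two STRONGER statements
`EisensteinPrimes.mem_of_red_of_good` (reducible ∧ good ⟹ `p ∈ {2,3,5,7,13,37}`, ordinarity not
needed) and `EisensteinPrimes.mem_of_red_of_mult` (reducible ∧ multiplicative ⟹ `p ∈ {2,3,5,7,13}`)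
from `hMaz` + `hT` by kernel valuation certificates (`EisensteinPrimesSupport.lean`). This leaf
records the one-line consequence

* `p136_mem_isogenyPrimes_of_reducible_of_mazur : hMaz → hT → A163`,

so that A163 is DERIVED (its consumers may substitute `(… hMaz hT)` for `hGr136`), and re-spells
the two large-prime headline theorems of `Partition/CornersLargePrimeThirteen.lean` with `hGr136`
so discharged (`…_of_mazur`). Nothing else is claimed.

References: R. Greenberg, LNM 1716 (1999) §5 p. 136 [GreenbergLNM1716]; B. Mazur, Invent. Math.
44 (1978) Thm. 1 and table p. 129 [Mazur1978]; J. E. Cremona, *Algorithms for Modular Elliptic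
Curves* (1997) §3.8 p. 82 [CremonaAlgorithms1997]; HOME/b2b-bsdres-lit-cgls/CGLS-GV-TYPING.md §18.
-/

set_option autoImplicit false

noncomputable section

open scoped Classical

open WeierstrassCurve Literature.NumberTheory.EllipticCurves
  Literature.NumberTheory.EllipticCurves.Rank1Residual Literature.NumberTheory.EllipticCurves.ModularForms
  Literature.NumberTheory.EllipticCurves.Greenberg1999
open scoped NumberField

namespace Summit.BirchSwinnertonDyer.Rank1Residual

/-- **Greenberg, LNM 1716 p. 136 (registry A163) from Mazur 1978 Thm. 1 + the `j`-table.** Granted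
`mazur_isogeny_irreducible` (`hMaz`) and `primeDegreeIsogeny_jTable` (`hT`), the named fact
`Greenberg1999.p136_mem_isogenyPrimes_of_reducible` HOLDS: at a prime of good ordinary or
multiplicative reduction with `E[p]` reducible, `p ∈ {2, 3, 5, 7, 13, 37}` — by
`EisensteinPrimes.mem_of_red_of_good` (the good case, ordinarity unused) and
`EisensteinPrimes.mem_of_red_of_mult` (the multiplicative case, which even excludes `37`).
[cite: GreenbergLNM1716, §5 p. 136] [cite: Mazur1978, Thm. 1 and table p. 129]
[cite: CremonaAlgorithms1997, §3.8 p. 82] -/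
theorem p136_mem_isogenyPrimes_of_reducible_of_mazur (hMaz : mazur_isogeny_irreducible)
    (hT : primeDegreeIsogeny_jTable) : p136_mem_isogenyPrimes_of_reducible := by
  intro W _ _ p _ hred hR
  rcases hred with hgo | hm
  · exact EisensteinPrimes.mem_of_red_of_good hMaz hT W p hR hgo.1
  · have h := EisensteinPrimes.mem_of_red_of_mult hMaz hT W p hR hm
    simp only [Finset.mem_insert, Finset.mem_singleton] at h ⊢
    rcases h with h | h | h | h | h
    · exact Or.inl h
    · exact Or.inr (Or.inl h)
    · exact Or.inr (Or.inr (Or.inl h))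
    · exact Or.inr (Or.inr (Or.inr (Or.inl h)))
    · exact Or.inr (Or.inr (Or.inr (Or.inr (Or.inl h))))

section Headlines

variable {W : WeierstrassCurve ℚ} [W.IsElliptic] [W.IsGloballyMinimal] {p : ℕ} [Fact p.Prime]

/-- **`BSD(E,p)` at every good ORDINARY `p ≥ 11`, `p ≠ 13`, analytic rank `≤ 1`, NO corner — with
Greenberg's p. 136 list (A163) replaced by its sources** Mazur 1978 Thm. 1 (`hMaz`) and the
`j`-table (`hT`): `bsdp_goodOrd_of_eleven_le_of_ne_thirteen_sharp` of
`Partition/CornersLargePrimeThirteen.lean` with `hGr136 := p136_mem_isogenyPrimes_of_reducible_of_mazur hMaz hT`.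
The other inputs are the published facts listed there (BCS 2025 Cor. 1.3.1, GZK, BDMTV 2019
Thm. 1.2, the CM rank-`0` BSD-triple fact, Kobayashi 2013 Cor. 1.4, modularity ×2, CGS 2025
Thm. D, GV 2000 Thm. 1.3, Greenberg 1999 Thm. 4.1) and the `j`-table itself.
[cite: Mazur1978, Thm. 1 and table p. 129] [cite: CremonaAlgorithms1997, §3.8 p. 82]
[cite: GreenbergLNM1716, §5 p. 136] -/
theorem bsdp_goodOrd_of_eleven_le_of_ne_thirteen_of_mazur
    (hBCS : BurungaleCastellaSkinner2025.cor131_padicValRat_bsd_rank_le_one)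
    (hGZK : rank_eq_analyticRank_of_analyticRank_le_one)
    (hBDMTV : BalakrishnanEtAl2019.thm12_not_le_normalizer_splitCartan)
    (hCM : bsdTriple_of_hasCM_of_L_one_ne_zero) (hKob : Kobayashi2013.cor14_bsdp_of_cm_rank_one)
    (hmod : hasEntireLFunction_rat) (hmodP : nonempty_modularParametrizationData)
    (hCGS : CastellaGrossiSkinner2025.thmD_padicValRat_bsd_rank_le_one)
    (hGV : GreenbergVatsal2000.thm13_charIdeal_eq_of_gvPar) (hGr : greenberg_charValue_rankZero)
    (hMaz : mazur_isogeny_irreducible) (hT : primeDegreeIsogeny_jTable)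
    (hr : W.analyticRank ≤ 1) (hgo : GoodOrd W p) (h11 : 11 ≤ p) (h13 : p ≠ 13) : BSDp W p :=
  bsdp_goodOrd_of_eleven_le_of_ne_thirteen_sharp hBCS hGZK hBDMTV hCM hKob hmod hmodP hCGS hGV hGr
    (p136_mem_isogenyPrimes_of_reducible_of_mazur hMaz hT) hT hr hgo h11 h13

/-- **`BSD(E,p)` at every MULTIPLICATIVE `p ≥ 11`, `p ≠ 13`, analytic rank `0`, unless X11a** — the
theorem `bsdp_mult_rankZero_of_eleven_le_of_ne_thirteen` of `Partition/CornersLargePrimeThirteen.lean`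
with `hGr136` discharged by `hMaz` + `hT` (reducible `E[p]` at a multiplicative `p ≥ 11` would need
`p = 13`: `EisensteinPrimes.mem_of_red_of_mult`).
[cite: Mazur1978, Thm. 1 and table p. 129] [cite: CremonaAlgorithms1997, §3.8 p. 82]
[cite: GreenbergLNM1716, §5 p. 136] -/
theorem bsdp_mult_rankZero_of_eleven_le_of_ne_thirteen_of_mazur
    (hSk : Skinner2016.thmC_padicValRat_bsd_rank_zero)
    (hmod : hasEntireLFunction_rat) (hGZK : rank_eq_analyticRank_of_analyticRank_le_one)
    (hMaz : mazur_isogeny_irreducible) (hT : primeDegreeIsogeny_jTable)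
    (hm : Mult W p) (hr0 : W.analyticRank = 0) (h11 : 11 ≤ p) (h13 : p ≠ 13)
    (hX11a : ¬ ClassX11a W p) : BSDp W p :=
  bsdp_mult_rankZero_of_eleven_le_of_ne_thirteen hSk hmod hGZK
    (p136_mem_isogenyPrimes_of_reducible_of_mazur hMaz hT) hT hm hr0 h11 h13 hX11a

/-- The (ram) form: at a multiplicative `p ≥ 11`, `p ≠ 13`, in analytic rank `0`, a second
multiplicative prime `q` with `p ∤ v_q(Δ_min)` gives `BSD(E,p)` — `hGr136` discharged by `hMaz` + `hT`.
[cite: Skinner2016PacificMC, Thm. C] [cite: Mazur1978, Thm. 1 and table p. 129]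
[cite: CremonaAlgorithms1997, §3.8 p. 82] -/
theorem bsdp_mult_rankZero_of_eleven_le_of_ram_of_ne_thirteen_of_mazur
    (hSk : Skinner2016.thmC_padicValRat_bsd_rank_zero)
    (hmod : hasEntireLFunction_rat) (hGZK : rank_eq_analyticRank_of_analyticRank_le_one)
    (hMaz : mazur_isogeny_irreducible) (hT : primeDegreeIsogeny_jTable)
    (hm : Mult W p) (hr0 : W.analyticRank = 0) (h11 : 11 ≤ p) (h13 : p ≠ 13) (hram : Ram W p) :
    BSDp W p :=
  bsdp_mult_rankZero_of_eleven_le_of_ram_of_ne_thirteen hSk hmod hGZK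
    (p136_mem_isogenyPrimes_of_reducible_of_mazur hMaz hT) hT hm hr0 h11 h13 hram

end Headlines

end Summit.BirchSwinnertonDyer.Rank1Residual

end
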